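import Summits.SmoothPoincare4.SmoothPoincare4.Theorems.SymplecticOrigamiGromovRecognitionRelEndStubFlatLeavesAux
import Summits.SmoothPoincare4.SmoothPoincare4.Theorems.SymplecticOrigamiGromovRecognitionRelEndStubFlatLeavesAux2
import Mathlib

/-!
# Flat leaves for `GromovRecognitionRelEnd` — the flat lines `{z₂ = c}` are `H`-leaves
(stub `stub_flatLeaves` of line `cross-cap-laurent`, crux `SymplecticOrigami.GromovRecognitionRelEnd`,
item stmt-SmoothPoincare4-11009; fifth auxiliary file: the `H` case, mirror image of file `Aux4`)

In the wedge cap `X = ι(M) ⊔ (H∞ ∪ V∞)` with its three product charts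
`ηV (u, z₂) = ι χ (1/u, z₂)`, `ηH (z₁, t) = ι χ (z₁, 1/t)`, `ηC (u, t) = ι χ (1/u, 1/t)` (only the
clauses of the cap block that are used appear as hypotheses, verbatim), let `lamH : X → X` be the
`C^∞` retraction onto `V∞` produced by the core stub (values in `V∞`, identity on the affine axis
`ηV {q₀ = q₁ = 0}`, corner criterion `lamH y = ηC 0 ↔ y ∈ H∞`, `JX`-invariant kernel, positive
holonomy — only the first three are used here).  This file builds (`flatLeaf_H_sphere`), for
`|z₂(w)| > R₁`, the flat line `{z₂ = (w₂, w₃)}` through `ι χ w` as a `C^∞` `JX`-sphere adapted to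
`lamH`, i.e. exactly the data consumed by the leaf-constancy theorem `FlatLeaves.leaf_const` of
file `Aux3` (applied in the stub file): with `c = (w₂, w₃)` and `a = 1/c`, the affine charts are
`u z = ηH (z, a)` (a `JX`-holomorphic slice of the holomorphic chart `ηH`) and `v z = u (1/z)`
extended by `v 0 = ηC (0, a) = ηV (0, c)`; `u` runs in `range ι`, hence misses `H∞`, so `u` and
`v` run in the open set `S = {lamH ≠ ηC 0}` on which `lamH` takes values in the affine axis of
`V∞`; the complex coordinates `z₂` (first) and `z₁` (second) of `ℝ⁴` are produced as real-linear
maps; and `u (w₀ + i w₁) = ι χ w`, `lamH (v 0) = ηV (0, c)`.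

Everything is proved; no definition, no named fact.

References: M. Gromov, *Pseudo holomorphic curves in symplectic manifolds*, Invent. Math. 82
(1985), 2.4.A₁′–A₂′ [Gromov1985].
-/

noncomputable section

-- the registered namespace `Summit.SmoothPoincare4.SmoothPoincare4.Theorems…` repeats a component
set_option linter.dupNamespace false

open scoped Manifold ContDiff Topology
open Set Function Filter Literature.Geometry.Symplectic

namespace Summit.SmoothPoincare4.SmoothPoincare4.Theorems.GromovRecognitionRelEnd.CrossCapLaurent

namespace FlatLeaves

open CapModel

/-! ## Coordinates of the `H`-slices `t ↦ (t, a₂, a₃)` -/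

section SliceH

variable (a₂ a₃ : ℝ)

/-- `|z₂|²` is constant along an `H`-slice. [folklore] -/
theorem r2_sliceH (t : ℂ) : r2 (WithLp.toLp 2 ![t.re, t.im, a₂, a₃] : EuclideanSpace ℝ (Fin 4)) = a₂ ^ 2 + a₃ ^ 2 := by
  simp [r2_def]

/-- `|z₁|² = |t|²` along an `H`-slice. [folklore] -/
theorem r1_sliceH (t : ℂ) :
    r1 (WithLp.toLp 2 ![t.re, t.im, a₂, a₃] : EuclideanSpace ℝ (Fin 4)) = Complex.normSq t := by
  simp [r1_def, Complex.normSq_apply, sq]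

/-- **The first inversion acts on an `H`-slice as `t ↦ 1/t`** (`1/t = t̄/|t|²`; also for `t = 0`
with the junk values `x/0 = 0`, `0⁻¹ = 0`). [folklore] -/
theorem inv1_sliceH (t : ℂ) : inv1 (WithLp.toLp 2 ![t.re, t.im, a₂, a₃] : EuclideanSpace ℝ (Fin 4)) =
    WithLp.toLp 2 ![t⁻¹.re, t⁻¹.im, a₂, a₃] := by
  ext i
  fin_cases i
  · simp [r1_def, Complex.inv_re, Complex.normSq_apply, sq, div_eq_mul_inv]
  · simp [r1_def, Complex.inv_im, Complex.normSq_apply, sq, div_eq_mul_inv, neg_mul]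
  · simp
  · simp

/-- **The second inversion straightens an `H`-slice**: for `a = 1/c` (`c = (w₂, w₃) ≠ 0`),
`inv₂ (t, a) = (t, c)`. [folklore] -/
theorem inv2_sliceH_inv2 (w : EuclideanSpace ℝ (Fin 4)) (hw : r2 w ≠ 0) (t : ℂ) :
    inv2 (WithLp.toLp 2 ![t.re, t.im, inv2 w 2, inv2 w 3] : EuclideanSpace ℝ (Fin 4)) =
      WithLp.toLp 2 ![t.re, t.im, w 2, w 3] := by
  have hr : r2 (WithLp.toLp 2 ![t.re, t.im, inv2 w 2, inv2 w 3] : EuclideanSpace ℝ (Fin 4)) = (r2 w)⁻¹ := by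
    rw [r2_sliceH, ← r2_inv2 w, r2_def (inv2 w)]
  have hr0 : (r2 w)⁻¹ ≠ 0 := inv_ne_zero hw
  ext i
  fin_cases i
  · show inv2 _ 0 = _
    simp
  · show inv2 _ 1 = _
    simp
  · show inv2 _ 2 = _
    rw [inv2_apply2, hr]
    simp
    field_simp
  · show inv2 _ 3 = _
    rw [inv2_apply3, hr]
    simp
    field_simp

end SliceH

/-! ## The `H` case -/

/-- **The flat line `{z₂ = c}`, `|c| > R₁`, as a `JX`-sphere adapted to `lamH`** (the data of
Gromov 1985, 2.4.A₂′ "suppose the form has been already split near `S₁ ∪ S₂`": here `J = i ⊕ i`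
beyond `R₁`).  See the file header. [cite: Gromov1985, 2.4.A₂′] -/
theorem flatLeaf_H_sphere {M X : Type*} [TopologicalSpace X] [T2Space X]
    [ChartedSpace (EuclideanSpace ℝ (Fin 4)) X]
    (JX : ∀ y : X, TangentSpace (𝓡 4) y →L[ℝ] TangentSpace (𝓡 4) y)
    (ι : M → X) (χ : EuclideanSpace ℝ (Fin 4) → M) (ηH ηV ηC : EuclideanSpace ℝ (Fin 4) → X) {R₁ : ℝ} (hR₁ : 0 < R₁)
    (hHloc : IsLocalDiffeomorphOn 𝓘(ℝ, EuclideanSpace ℝ (Fin 4)) (𝓡 4) ∞ ηH {p : EuclideanSpace ℝ (Fin 4) | p 2 ^ 2 + p 3 ^ 2 < R₁⁻¹ ^ 2})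
    (hHglue : ∀ p : EuclideanSpace ℝ (Fin 4), p 2 ^ 2 + p 3 ^ 2 < R₁⁻¹ ^ 2 → (p 2 ≠ 0 ∨ p 3 ≠ 0) →
      ηH p = ι (χ (WithLp.toLp 2
        ![p 0, p 1, p 2 / (p 2 ^ 2 + p 3 ^ 2), -(p 3) / (p 2 ^ 2 + p 3 ^ 2)])))
    (hHax : ∀ p : EuclideanSpace ℝ (Fin 4), p 2 = 0 → p 3 = 0 → ηH p ∉ Set.range ι)
    (hHhol : ∀ p : EuclideanSpace ℝ (Fin 4), p 2 ^ 2 + p 3 ^ 2 < R₁⁻¹ ^ 2 → ∀ q : EuclideanSpace ℝ (Fin 4),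
      JX (ηH p) (mfderiv 𝓘(ℝ, EuclideanSpace ℝ (Fin 4)) (𝓡 4) ηH p q) =
        mfderiv 𝓘(ℝ, EuclideanSpace ℝ (Fin 4)) (𝓡 4) ηH p (WithLp.toLp 2 ![-(q 1), q 0, -(q 3), q 2]))
    (hCloc : IsLocalDiffeomorphOn 𝓘(ℝ, EuclideanSpace ℝ (Fin 4)) (𝓡 4) ∞ ηC
      {p : EuclideanSpace ℝ (Fin 4) | p 0 ^ 2 + p 1 ^ 2 < R₁⁻¹ ^ 2 ∧ p 2 ^ 2 + p 3 ^ 2 < R₁⁻¹ ^ 2})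
    (hCinj : Set.InjOn ηC {p : EuclideanSpace ℝ (Fin 4) | p 0 ^ 2 + p 1 ^ 2 < R₁⁻¹ ^ 2 ∧ p 2 ^ 2 + p 3 ^ 2 < R₁⁻¹ ^ 2})
    (hCV : ∀ p : EuclideanSpace ℝ (Fin 4), p 0 ^ 2 + p 1 ^ 2 < R₁⁻¹ ^ 2 → p 2 ^ 2 + p 3 ^ 2 < R₁⁻¹ ^ 2 →
      (p 2 ≠ 0 ∨ p 3 ≠ 0) →
      ηC p = ηV (WithLp.toLp 2 ![p 0, p 1, p 2 / (p 2 ^ 2 + p 3 ^ 2), -(p 3) / (p 2 ^ 2 + p 3 ^ 2)]))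
    (hCH : ∀ p : EuclideanSpace ℝ (Fin 4), p 0 ^ 2 + p 1 ^ 2 < R₁⁻¹ ^ 2 → p 2 ^ 2 + p 3 ^ 2 < R₁⁻¹ ^ 2 →
      (p 0 ≠ 0 ∨ p 1 ≠ 0) →
      ηC p = ηH (WithLp.toLp 2 ![p 0 / (p 0 ^ 2 + p 1 ^ 2), -(p 1) / (p 0 ^ 2 + p 1 ^ 2), p 2, p 3]))
    (hC0 : ηC 0 ∉ Set.range ι)
    (lamH : X → X) (hlam : ContMDiff (𝓡 4) (𝓡 4) ∞ lamH)
    (hinto : ∀ y : X, (∃ q : EuclideanSpace ℝ (Fin 4), q 0 = 0 ∧ q 1 = 0 ∧ ηV q = lamH y) ∨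
      lamH y = ηC 0)
    (hret : ∀ q : EuclideanSpace ℝ (Fin 4), q 0 = 0 → q 1 = 0 → lamH (ηV q) = ηV q)
    (hcorn : ∀ y : X, lamH y = ηC 0 ↔
      ((∃ p : EuclideanSpace ℝ (Fin 4), p 2 = 0 ∧ p 3 = 0 ∧ ηH p = y) ∨ y = ηC 0))
    (w : EuclideanSpace ℝ (Fin 4)) (hw : R₁ ^ 2 < w 2 ^ 2 + w 3 ^ 2) :
    ∃ (π₁ π₂ : EuclideanSpace ℝ (Fin 4) →L[ℝ] ℂ) (S : Set X) (u v : ℂ → X),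
      (∀ q, π₁ (I4 q) = Complex.I * π₁ q) ∧ (∀ q, π₁ q = 0 → π₂ q = 0 → q = 0) ∧ IsOpen S ∧
      (∀ y ∈ S, ∃ q ∈ {p : EuclideanSpace ℝ (Fin 4) | p 0 ^ 2 + p 1 ^ 2 < R₁⁻¹ ^ 2},
        π₂ q = 0 ∧ ηV q = lamH y) ∧
      ContMDiff 𝓘(ℝ, ℂ) (𝓡 4) ∞ u ∧ ContMDiff 𝓘(ℝ, ℂ) (𝓡 4) ∞ v ∧ (∀ z : ℂ, z ≠ 0 → v z = u z⁻¹) ∧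
      IsJHolomorphic (𝓡 4) JX u ∧ (∀ z, u z ∈ S) ∧ (∀ z, v z ∈ S) ∧
      u ⟨w 0, w 1⟩ = ι (χ w) ∧ lamH (v 0) = ηV (WithLp.toLp 2 ![0, 0, w 2, w 3]) := by
  -- linear algebra of `ℝ⁴ = ℂ²`: now `π₁ = z₂`, `π₂ = z₁`
  obtain ⟨π₂, hπ₂, -⟩ := exists_clm_coord01
  obtain ⟨π₁, hπ₁, hπ₁I⟩ := exists_clm_coord23
  obtain ⟨T, hT, hTI⟩ := exists_clm_slice01
  have hπ : ∀ q : EuclideanSpace ℝ (Fin 4), π₁ q = 0 → π₂ q = 0 → q = 0 := fun q h1 h2 =>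
    eq_zero_of_coords hπ₂ hπ₁ h2 h1
  -- the three coordinate domains
  set DV : Set (EuclideanSpace ℝ (Fin 4)) := {p : EuclideanSpace ℝ (Fin 4) | p 0 ^ 2 + p 1 ^ 2 < R₁⁻¹ ^ 2} with hDV
  set DH : Set (EuclideanSpace ℝ (Fin 4)) := {p : EuclideanSpace ℝ (Fin 4) | p 2 ^ 2 + p 3 ^ 2 < R₁⁻¹ ^ 2} with hDH
  set DC : Set (EuclideanSpace ℝ (Fin 4)) := {p : EuclideanSpace ℝ (Fin 4) | p 0 ^ 2 + p 1 ^ 2 < R₁⁻¹ ^ 2 ∧ p 2 ^ 2 + p 3 ^ 2 < R₁⁻¹ ^ 2}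
    with hDC
  have hR : (0 : ℝ) < R₁⁻¹ ^ 2 := by positivity
  -- the point: `c = (w₂, w₃)`, `a = 1/c`
  have hr2w : R₁ ^ 2 < r2 w := hw
  have hr2w0 : r2 w ≠ 0 := r2_ne_zero_of_sq_lt hr2w
  have hr2a : (inv2 w 2) ^ 2 + (inv2 w 3) ^ 2 < R₁⁻¹ ^ 2 := by
    have h := r2_inv2_lt hR₁ hr2w
    rwa [r2_def] at h
  have ha0 : inv2 w 2 ≠ 0 ∨ inv2 w 3 ≠ 0 := by
    have h : r2 (inv2 w) ≠ 0 := by rw [r2_inv2]; exact inv_ne_zero hr2w0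
    exact (r2_ne_zero_iff _).1 h
  -- the slice `s t = (t, a)` and its coordinates
  set s : ℂ → EuclideanSpace ℝ (Fin 4) := fun t => WithLp.toLp 2 ![t.re, t.im, inv2 w 2, inv2 w 3] with hs
  have hs_fd : ∀ t, HasFDerivAt s T t := hasFDerivAt_slice01 hT (inv2 w 2) (inv2 w 3)
  have hs0 : ∀ t, s t 0 = t.re := fun t => by simp [hs]
  have hs1 : ∀ t, s t 1 = t.im := fun t => by simp [hs]
  have hs2 : ∀ t, s t 2 = inv2 w 2 := fun t => by simp [hs]
  have hs3 : ∀ t, s t 3 = inv2 w 3 := fun t => by simp [hs]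
  have hsDH : ∀ t, s t ∈ DH := fun t => by
    show s t 2 ^ 2 + s t 3 ^ 2 < R₁⁻¹ ^ 2
    rw [hs2, hs3]; exact hr2a
  have hsoff : ∀ t, s t 2 ≠ 0 ∨ s t 3 ≠ 0 := fun t => by rw [hs2, hs3]; exact ha0
  have hsDC : ∀ t : ℂ, Complex.normSq t < R₁⁻¹ ^ 2 → s t ∈ DC := fun t ht =>
    ⟨by show r1 (s t) < R₁⁻¹ ^ 2; rw [hs, r1_sliceH]; exact ht, hsDH t⟩
  have hinv2s : ∀ t, inv2 (s t) = WithLp.toLp 2 ![t.re, t.im, w 2, w 3] := fun t =>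
    inv2_sliceH_inv2 w hr2w0 t
  have hinv1s : ∀ t, inv1 (s t) = s t⁻¹ := fun t => inv1_sliceH _ _ t
  -- the first affine chart `u = ηH ∘ s` of the flat line
  set u : ℂ → X := fun t => ηH (s t) with hu
  have hHD : ∀ p ∈ DH, ContMDiffAt 𝓘(ℝ, EuclideanSpace ℝ (Fin 4)) (𝓡 4) ∞ ηH p := fun p hp =>
    contMDiffAt_of_mem hHloc hp
  have hu_smooth : ContMDiff 𝓘(ℝ, ℂ) (𝓡 4) ∞ u := contMDiff_comp_slice hHD hs_fd hsDH
  have hu_hol : IsJHolomorphic (𝓡 4) JX u :=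
    isJHolomorphic_comp_slice (fun p hp => (hHD p hp).mdifferentiableAt (by simp))
      (fun p hp q => hHhol p hp q) hs_fd hTI hsDH
  have hu_glue : ∀ t, u t = ι (χ (inv2 (s t))) := fun t => hHglue (s t) (hsDH t) (hsoff t)
  have hu_range : ∀ t, u t ∈ Set.range ι := fun t => ⟨χ (inv2 (s t)), (hu_glue t).symm⟩
  have hu_base : u ⟨w 0, w 1⟩ = ι (χ w) := by
    rw [hu_glue, hinv2s]
    congr 2
    ext i
    fin_cases i <;> simp
  -- the second affine chart `v = u (1/t)`, `v 0 = ηC (0, a) = ηV (0, c)`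
  set v : ℂ → X := fun t => if t = 0 then ηC (s 0) else u t⁻¹ with hv
  have hCt : ∀ t : ℂ, Complex.normSq t < R₁⁻¹ ^ 2 → t ≠ 0 → ηC (s t) = u t⁻¹ := by
    intro t ht ht0
    have h01 : s t 0 ≠ 0 ∨ s t 1 ≠ 0 := by
      rw [hs0, hs1]
      by_contra hc
      simp only [not_or, not_not] at hc
      exact ht0 (Complex.ext hc.1 hc.2)
    rw [hCH (s t) (hsDC t ht).1 (hsDC t ht).2 h01]
    show ηH (inv1 (s t)) = ηH (s t⁻¹)
    rw [hinv1s]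
  have hC0s : ContMDiffAt 𝓘(ℝ, ℂ) (𝓡 4) ∞ (fun t => ηC (s t)) 0 :=
    (contMDiffAt_of_mem hCloc (hsDC 0 (by simpa using hR))).comp 0
      (contDiff_of_hasFDerivAt_const hs_fd).contMDiff.contMDiffAt
  have hv_smooth : ContMDiff 𝓘(ℝ, ℂ) (𝓡 4) ∞ v :=
    contMDiff_inversionGlue hu_smooth hC0s
      ((eventually_normSq_lt hR).mono fun t ht ht0 => hCt t ht ht0)
  have huv : ∀ t : ℂ, t ≠ 0 → v t = u t⁻¹ := fun t ht => if_neg ht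
  have hv0 : v 0 = ηV (WithLp.toLp 2 ![0, 0, w 2, w 3]) := by
    have h0 : v 0 = ηC (s 0) := if_pos rfl
    rw [h0, hCV (s 0) (hsDC 0 (by simpa using hR)).1 (hsDC 0 (by simpa using hR)).2 (hsoff 0)]
    show ηV (inv2 (s 0)) = _
    rw [hinv2s]
    simp
  -- the open set `S = {lamH ≠ corner}` where `lamH` reads in the affine chart of `V∞`
  set S : Set X := {y : X | lamH y ≠ ηC 0} with hSdef
  have hS : IsOpen S := isOpen_ne_fun hlam.continuous continuous_const
  have hSax : ∀ y ∈ S, ∃ q ∈ DV, π₂ q = 0 ∧ ηV q = lamH y := by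
    intro y hy
    rcases hinto y with ⟨q, hq0, hq1, hqy⟩ | h
    · refine ⟨q, ?_, ?_, hqy⟩
      · show q 0 ^ 2 + q 1 ^ 2 < R₁⁻¹ ^ 2
        rw [hq0, hq1]; simpa using hR
      · rw [hπ₂, hq0, hq1]; rfl
    · exact absurd h hy
  have hrangeS : ∀ y ∈ Set.range ι, y ∈ S := by
    rintro _ ⟨x, rfl⟩ h
    rcases (hcorn (ι x)).1 h with ⟨p, hp2, hp3, hpy⟩ | h'
    · exact hHax p hp2 hp3 ⟨x, hpy.symm⟩
    · exact hC0 ⟨x, h'⟩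
  have huS : ∀ t, u t ∈ S := fun t => hrangeS _ (hu_range t)
  have hcornerV : ηV (WithLp.toLp 2 ![0, 0, w 2, w 3]) ≠ ηC 0 := by
    intro h
    have h1 : ηC (s 0) = ηC 0 := by rw [← h, ← hv0]; exact (if_pos rfl).symm
    have h0DC : (0 : EuclideanSpace ℝ (Fin 4)) ∈ DC := ⟨by simpa using hR, by simpa using hR⟩
    have hs00 := hCinj (hsDC 0 (by simpa using hR)) h0DC h1
    rcases hsoff 0 with h0 | h0
    · exact h0 (by rw [hs00]; rfl)
    · exact h0 (by rw [hs00]; rfl)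
  have hvS : ∀ t, v t ∈ S := by
    intro t
    by_cases ht : t = 0
    · subst ht
      show lamH (v 0) ≠ ηC 0
      rw [hv0, hret _ (by simp) (by simp)]
      exact hcornerV
    · rw [huv t ht]; exact huS _
  exact ⟨π₁, π₂, S, u, v, hπ₁I, hπ, hS, hSax, hu_smooth, hv_smooth, huv, hu_hol, huS, hvS, hu_base,
    by rw [hv0, hret _ (by simp) (by simp)]⟩

end FlatLeaves

/-- **Registered helper sub-goal `helper_flatLeavesSliceInversionH`** (fifth auxiliary file of stub
`stub_flatLeaves`): on an `H`-slice `t ↦ (t, a₂, a₃)` of `ℝ⁴ = ℂ²` the inversion of the first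
factor (the transition map of the cap charts, written with the junk value `x/0 = 0` as in the
registered signature) is `t ↦ 1/t`. [folklore] -/
theorem helper_flatLeavesSliceInversionH : ∀ (a₂ a₃ : ℝ) (t : ℂ),
    (WithLp.toLp 2 ![t.re / (t.re ^ 2 + t.im ^ 2), -t.im / (t.re ^ 2 + t.im ^ 2), a₂, a₃] :
      EuclideanSpace ℝ (Fin 4)) = WithLp.toLp 2 ![t⁻¹.re, t⁻¹.im, a₂, a₃] := by
  intro a₂ a₃ t
  have h := FlatLeaves.inv1_sliceH a₂ a₃ t
  rw [CapModel.inv1] at h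
  simpa using h

end Summit.SmoothPoincare4.SmoothPoincare4.Theorems.GromovRecognitionRelEnd.CrossCapLaurent
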